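import Summits.QuantumFields.YangMills.Theorems.BalabanUVNodesN07AliasSumRobustBoundCore
import HarnessLib

/-!
# DAG node N07 — THE ROBUST ONE-LEVEL INEQUALITY (R1L) IN DISPLAY FORM: the alias sum of `(1 − Π f)²∕(Σ S)⁴` against the
# matched alias sum `Π f²∕(Σ S)²`, with an explicit constant, for every odd block side `n ≥ 3`, every dimension, every coarse momentum

Width seat `pub-ymgap-dag-n07-w7` (g6), count-neutral helper (`--supports … --as helper`); socket (S2) of the located (L4) road
(HOME `pub-ymgap-dag-n07-w7/LOCATED-KPOS-MULTILEVEL.md` §3–§4).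

WHY.  On one averaging level (torus tiled by `n`-cubes, block means `P`, centre sampling `Π`) this lineage proved the SHARP margin
`⟨f, (Π − P)Δ⁻²f⟩ ≥ 0` for block-constant `f` (g5 `…N07AliasSumMarginSharp`).  The localisation road to the multi-level point-feasibility
lemma (P)_D pairs a block-constant `f` with the solution of a NON-block-constant forcing `r` (the commutator residual of a cut-off), and
needs `|⟨f, (Π − P)Δ⁻²r⟩| ≤ √C·⟨f, Δ⁻²f⟩^{1∕2}·n²‖r‖` (R1L).  By Parseval and Cauchy–Schwarz in the alias index this is the per-frequency
DISPLAY inequality typed here: with the Dirichlet ratio `F(θ,m) = sin((θ+2πm)∕2)∕(n·sin((θ+2πm)∕(2n)))` (`F(0,m) = δ_{m,0}`) and the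
Laplacian symbol `S(θ,m) = 4n²sin²((θ+2πm)∕(2n))` (dag-n07-w5's letters `f`, `Sxir`; `|e^{i(p′+l)ηc₀} − conj u(p′+l)|² = (1 − Π_κ F)²`),
★★★ `aliasSum_robust_bound`:
`Σ_{m ∈ [0,n)^ι} (1 − Π_κ F(θ_κ,m_κ))² ∕ (Σ_κ S(θ_κ,m_κ))⁴ ≤ (π²∕4)^{|ι|}·(π⁴∕1024 + |ι|²π⁴n^{|ι|}∕64) · Σ_m (Π_κ F(θ_κ,m_κ))² ∕ (Σ_κ S(θ_κ,m_κ))²`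
for every finite index type `ι`, every `θ ∈ [0,2π)^ι` not identically `0`, every odd `n ≥ 3`.  The constant is crude (numerically the best
constant is `3.2e−3` for `|ι| = 1`, `5.2e−3` for `|ι| = 2` at `n = 3`, attained at `θ = π`); only its INDEPENDENCE of `θ` (hence of the coarse
torus) matters for the road.  Mechanism: split off the NEAREST alias `m*` (per coordinate: `m* = 0` for `θ ≤ π`, `m* = n−1` for `θ > π`, the
latter reduced to the former by `θ ↦ 2π − θ`, `n` odd): there `F ≥ 2∕π` (Jordan twice), `1 − F ≤ (π²∕32)·S` (`tan y ≥ y`, `cos y ≥ 1 − y²∕2`,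
Jordan) and `S ≤ π²`; every other alias has `S ≥ 4`; and `1 − Πa ≤ Σ(1 − a)` on `[0,1]`.
* §1 one-variable trigonometry: `mul_cos_le_sin`, `two_div_pi_mul_le_sin_of_mem`, `dirRatio_ge_cos`, `two_div_pi_le_dirRatio`,
  `one_sub_dirRatio_le`, `abs_dirRatio_le_one`;
* §2 the letters `dirF`, `symS` and the nearest ∕ far alias facts: `dirF_reflect`, `symS_reflect`, `nearestAlias_bounds`, `four_le_symS_of_ne`;
* §3 `one_sub_prod_le_sum`, ★★★ `aliasSum_robust_bound`.

HONEST SCOPE.  Elementary real analysis; asserts NOTHING about [B11]∕[B6]∕[3]; the x-space form of (R1L) (Parseval + dag-n07-w5's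
`dft_sample` ∕ `dft_QsOp_adjoint`), the regularity sockets (S3) and the assembly (S4)–(S5) of the road are NOT here; (P)_D for Bałaban's
`d = 4` geometries OPEN; `hker` at the record, stub 1, K0⁷ ∕ K1⁹ NOT closed; N07 not discharged; nothing continuum ∕ OS ∕ mass gap.
Context only (no hypothesis is a citation): T. Bałaban, CMP **95** (1984) 17–40 [Balaban1984PropagatorsI] (1.29)–(1.33); CMP **109** (1987)
249–301 [Balaban1987RG1] (0.4).

FILE SPLIT (400-line cap): §1–§2 (trigonometry, letters `dirF`∕`symS`, nearest∕far aliases) live in the CORE file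
`…N07AliasSumRobustBoundCore`; this file is §3.
-/

set_option autoImplicit false

noncomputable section

open Finset Real

namespace Summit.QuantumFields.YangMills.Theorems.N07AliasSumRobustBound

/-! ## §3  The robust bound -/

/-- `1 − Π aᵢ ≤ Σ (1 − aᵢ)` for numbers in `[0, 1]` (the same elementary inequality is typed in another summit tree as
`Summit.AtomisticToContinuum.BoseEinsteinCondensation.Cruxes.OneBodyEntropyBound.Birth.ProductJastrow.one_sub_prod_le_sum`,
not importable here). [folklore] -/
theorem one_sub_prod_le_sum {ι : Type*} (s : Finset ι) (a : ι → ℝ) (ha : ∀ i ∈ s, 0 ≤ a i ∧ a i ≤ 1) :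
    1 - ∏ i ∈ s, a i ≤ ∑ i ∈ s, (1 - a i) := by
  classical
  induction s using Finset.induction_on with
  | empty => simp
  | insert j s hj ih =>
    rw [Finset.prod_insert hj, Finset.sum_insert hj]
    have hj' := ha j (Finset.mem_insert_self j s)
    have hs : ∀ i ∈ s, 0 ≤ a i ∧ a i ≤ 1 := fun i hi => ha i (Finset.mem_insert_of_mem hi)
    have hP0 : 0 ≤ ∏ i ∈ s, a i := Finset.prod_nonneg (fun i hi => (hs i hi).1)
    have hP1 : ∏ i ∈ s, a i ≤ 1 := Finset.prod_le_one (fun i hi => (hs i hi).1) (fun i hi => (hs i hi).2)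
    have ih' := ih hs
    nlinarith [hj'.1, hj'.2, hP0, hP1, ih']

/-- ★★★ **THE ROBUST ONE-LEVEL BOUND (R1L), display form.**  For a finite index type `ι`, an odd block side `n ≥ 3` and angles
`θ ∈ [0, 2π)^ι` not all zero,
`Σ_{m : ι → Fin n} (1 − Π_κ F(θ_κ,m_κ))² ∕ (Σ_κ S(θ_κ,m_κ))⁴ ≤ (π²∕4)^{|ι|}·(π⁴∕1024 + |ι|²·π⁴·n^{|ι|}∕64) · Σ_m (Π_κ F(θ_κ,m_κ))² ∕ (Σ_κ S(θ_κ,m_κ))²`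
with the display letters `F`, `S` given as hypotheses `hF`, `hS` (see the CORE file).  (Nearest alias: `(1−ΠF*)² ≤ (π²∕32)²(ΣS*)²`, `ΣS* ≤ |ι|π²`, `ΠF* ≥ (2∕π)^{|ι|}`; every other alias:
`ΣS ≥ 4` and `(1−ΠF)² ≤ 4`.)  Independent of `θ`, hence of the coarse torus. [folklore] -/
theorem aliasSum_robust_bound {ι : Type*} [Fintype ι] [DecidableEq ι] {n : ℕ} (hn : Odd n) (h3 : 3 ≤ n)
    (F : ℝ → ℕ → ℝ)
    (hF : F = fun (θ : ℝ) (m : ℕ) => if θ = 0 then (if m = 0 then (1 : ℝ) else 0) else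
      sin ((θ + 2 * π * (m : ℝ)) / 2) / ((n : ℝ) * sin ((θ + 2 * π * (m : ℝ)) / (2 * (n : ℝ)))))
    (S : ℝ → ℕ → ℝ) (hS : S = fun (θ : ℝ) (m : ℕ) => 4 * (n : ℝ) ^ 2 * sin ((θ + 2 * π * (m : ℝ)) / (2 * (n : ℝ))) ^ 2)
    (θ : ι → ℝ) (hθ : ∀ κ, 0 ≤ θ κ ∧ θ κ < 2 * π) (hne : ∃ κ, θ κ ≠ 0) :
    ∑ m : ι → Fin n, (1 - ∏ κ, F (θ κ) (m κ)) ^ 2 / (∑ κ, S (θ κ) (m κ)) ^ 4 ≤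
      (π ^ 2 / 4) ^ Fintype.card ι *
          (π ^ 4 / 1024 + (Fintype.card ι : ℝ) ^ 2 * π ^ 4 * (n : ℝ) ^ Fintype.card ι / 64) *
        ∑ m : ι → Fin n, (∏ κ, F (θ κ) (m κ)) ^ 2 / (∑ κ, S (θ κ) (m κ)) ^ 2 := by
  have h1 : 1 ≤ n := by omega
  have hnpos : 0 < n := by omega
  -- the nearest alias, coordinate by coordinate
  let ms : ι → Fin n := fun κ => if θ κ ≤ π then ⟨0, hnpos⟩ else ⟨n - 1, by omega⟩
  have hms_val : ∀ κ, ((ms κ : Fin n) : ℕ) = if θ κ ≤ π then 0 else n - 1 := by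
    intro κ; simp only [ms]; split_ifs <;> rfl
  -- per-coordinate facts at the nearest alias
  have near : ∀ κ, 2 / π ≤ F (θ κ) (ms κ) ∧ F (θ κ) (ms κ) ≤ 1 ∧
      1 - F (θ κ) (ms κ) ≤ π ^ 2 / 32 * S (θ κ) (ms κ) ∧ S (θ κ) (ms κ) ≤ π ^ 2 ∧
      (θ κ ≠ 0 → 0 < S (θ κ) (ms κ)) := by
    intro κ
    rw [hms_val κ]
    by_cases hle : θ κ ≤ π
    · rw [if_pos hle]; exact nearestAlias_zero h1 F hF S hS (hθ κ).1 hle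
    · rw [if_neg hle]
      have hle' : π < θ κ := lt_of_not_ge hle
      obtain ⟨a, b, c, e, f⟩ := nearestAlias_last hn h1 F hF S hS hle' (hθ κ).2
      exact ⟨a, b, c, e, fun _ => f⟩
  -- far aliases
  have far : ∀ (m : ι → Fin n), m ≠ ms → (4 : ℝ) ≤ ∑ κ, S (θ κ) (m κ) := by
    intro m hm
    obtain ⟨κ, hκ⟩ := Function.ne_iff.mp hm
    have hfar : (θ κ ≤ π ∧ ((m κ : Fin n) : ℕ) ≠ 0) ∨ (π < θ κ ∧ ((m κ : Fin n) : ℕ) ≠ n - 1) := by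
      by_cases hle : θ κ ≤ π
      · left; refine ⟨hle, fun h0 => hκ ?_⟩
        apply Fin.ext; rw [h0, hms_val κ, if_pos hle]
      · right
        have hle' : π < θ κ := lt_of_not_ge hle
        refine ⟨hle', fun h0 => hκ ?_⟩
        apply Fin.ext; rw [h0, hms_val κ, if_neg hle]
    have h4 := four_le_symS_of_far h1 S hS (hθ κ).1 (hθ κ).2 (m κ).isLt hfar
    calc (4 : ℝ) ≤ S (θ κ) (m κ) := h4
      _ ≤ ∑ κ', S (θ κ') (m κ') :=
          Finset.single_le_sum (fun κ' _ => symS_nonneg n S hS (θ κ') (m κ')) (Finset.mem_univ κ)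
  -- abbreviations
  set c : ℕ := Fintype.card ι with hc
  set Sst : ℝ := ∑ κ, S (θ κ) (ms κ) with hSst
  set Fst : ℝ := ∏ κ, F (θ κ) (ms κ) with hFst
  have hc1 : (1 : ℝ) ≤ c := by
    obtain ⟨κ, _⟩ := hne
    have : 0 < Fintype.card ι := Fintype.card_pos_iff.mpr ⟨κ⟩
    exact_mod_cast this
  -- Σ S* : positive and ≤ c π²
  have hSst_pos : 0 < Sst := by
    obtain ⟨κ, hκ⟩ := hne
    have := (near κ).2.2.2.2 hκ
    calc (0 : ℝ) < S (θ κ) (ms κ) := this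
      _ ≤ Sst := Finset.single_le_sum (fun κ' _ => symS_nonneg n S hS (θ κ') (ms κ')) (Finset.mem_univ κ)
  have hSst_le : Sst ≤ c * π ^ 2 := by
    calc Sst ≤ ∑ _κ : ι, π ^ 2 := Finset.sum_le_sum (fun κ _ => (near κ).2.2.2.1)
      _ = c * π ^ 2 := by rw [Finset.sum_const, nsmul_eq_mul, hc, Finset.card_univ]
  -- Π F* ≥ (2/π)^c and ≤ 1
  have hFst_ge : (2 / π) ^ c ≤ Fst := by
    have : ∏ _κ : ι, (2 / π : ℝ) ≤ Fst :=
      Finset.prod_le_prod (fun κ _ => by positivity) (fun κ _ => (near κ).1)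
    rwa [Finset.prod_const, Finset.card_univ, ← hc] at this
  have hFst_le : Fst ≤ 1 := Finset.prod_le_one (fun κ _ => le_trans (by positivity) (near κ).1) (fun κ _ => (near κ).2.1)
  have hFst_pos : 0 < Fst := lt_of_lt_of_le (by positivity) hFst_ge
  -- 1 − Π F* ≤ (π²/32) Σ S*
  have hdef : 1 - Fst ≤ π ^ 2 / 32 * Sst := by
    have h := one_sub_prod_le_sum (Finset.univ : Finset ι) (fun κ => F (θ κ) (ms κ))
      (fun κ _ => ⟨le_trans (by positivity) (near κ).1, (near κ).2.1⟩)
    calc 1 - Fst ≤ ∑ κ, (1 - F (θ κ) (ms κ)) := h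
      _ ≤ ∑ κ, π ^ 2 / 32 * S (θ κ) (ms κ) := Finset.sum_le_sum (fun κ _ => (near κ).2.2.1)
      _ = π ^ 2 / 32 * Sst := by rw [← Finset.mul_sum]
  -- the nearest-alias term of the left side
  have hTst : (1 - Fst) ^ 2 / Sst ^ 4 ≤ (π ^ 4 / 1024) / Sst ^ 2 := by
    have h0 : 0 ≤ 1 - Fst := by linarith
    have hsq : (1 - Fst) ^ 2 ≤ (π ^ 2 / 32 * Sst) ^ 2 := pow_le_pow_left₀ h0 hdef 2
    rw [div_le_div_iff₀ (by positivity) (by positivity)]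
    calc (1 - Fst) ^ 2 * Sst ^ 2 ≤ (π ^ 2 / 32 * Sst) ^ 2 * Sst ^ 2 := by gcongr
      _ = π ^ 4 / 1024 * Sst ^ 4 := by ring
  -- the far terms of the left side
  have hTfar : ∀ m : ι → Fin n, m ≠ ms →
      (1 - ∏ κ, F (θ κ) (m κ)) ^ 2 / (∑ κ, S (θ κ) (m κ)) ^ 4 ≤ 1 / 64 := by
    intro m hm
    have hS4 := far m hm
    have hP : |∏ κ, F (θ κ) (m κ)| ≤ 1 := by
      rw [Finset.abs_prod]
      exact Finset.prod_le_one (fun κ _ => abs_nonneg _) (fun κ _ => abs_dirF_le_one h1 F hF (θ κ) (m κ))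
    have hP' := abs_le.mp hP
    have hnum : (1 - ∏ κ, F (θ κ) (m κ)) ^ 2 ≤ 4 := by nlinarith [hP'.1, hP'.2]
    have hden : (4 : ℝ) ^ 4 ≤ (∑ κ, S (θ κ) (m κ)) ^ 4 := pow_le_pow_left₀ (by norm_num) hS4 4
    rw [div_le_div_iff₀ (lt_of_lt_of_le (by norm_num) hden) (by norm_num)]
    nlinarith [hnum, hden]
  -- split the left sum at m*
  have hL : ∑ m : ι → Fin n, (1 - ∏ κ, F (θ κ) (m κ)) ^ 2 / (∑ κ, S (θ κ) (m κ)) ^ 4 ≤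
      (π ^ 4 / 1024) / Sst ^ 2 + (n : ℝ) ^ c / 64 := by
    rw [← Finset.add_sum_erase _ _ (Finset.mem_univ ms)]
    have hrest : ∑ m ∈ (Finset.univ : Finset (ι → Fin n)).erase ms,
        (1 - ∏ κ, F (θ κ) (m κ)) ^ 2 / (∑ κ, S (θ κ) (m κ)) ^ 4 ≤ (n : ℝ) ^ c / 64 := by
      calc ∑ m ∈ (Finset.univ : Finset (ι → Fin n)).erase ms,
            (1 - ∏ κ, F (θ κ) (m κ)) ^ 2 / (∑ κ, S (θ κ) (m κ)) ^ 4
          ≤ ∑ _m ∈ (Finset.univ : Finset (ι → Fin n)).erase ms, (1 / 64 : ℝ) :=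
            Finset.sum_le_sum (fun m hm => hTfar m (Finset.ne_of_mem_erase hm))
        _ = (((Finset.univ : Finset (ι → Fin n)).erase ms).card : ℝ) * (1 / 64) := by
            rw [Finset.sum_const, nsmul_eq_mul]
        _ ≤ (n : ℝ) ^ c * (1 / 64) := by
            gcongr
            have hcard : ((Finset.univ : Finset (ι → Fin n)).erase ms).card ≤ n ^ c := by
              calc ((Finset.univ : Finset (ι → Fin n)).erase ms).card ≤ (Finset.univ : Finset (ι → Fin n)).card :=
                    Finset.card_erase_le
                _ = n ^ c := by rw [Finset.card_univ, Fintype.card_fun, Fintype.card_fin, hc]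
            exact_mod_cast hcard
        _ = (n : ℝ) ^ c / 64 := by ring
    have := hTst
    linarith
  -- the right sum from below by its m* term
  have hR : Fst ^ 2 / Sst ^ 2 ≤ ∑ m : ι → Fin n, (∏ κ, F (θ κ) (m κ)) ^ 2 / (∑ κ, S (θ κ) (m κ)) ^ 2 := by
    have hnn : ∀ m ∈ (Finset.univ : Finset (ι → Fin n)),
        0 ≤ (∏ κ, F (θ κ) (m κ)) ^ 2 / (∑ κ, S (θ κ) (m κ)) ^ 2 := fun m _ => by positivity
    exact Finset.single_le_sum hnn (Finset.mem_univ ms)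
  -- assemble
  have hC0 : 0 ≤ (π ^ 2 / 4) ^ c * (π ^ 4 / 1024 + (c : ℝ) ^ 2 * π ^ 4 * (n : ℝ) ^ c / 64) := by positivity
  have key : (π ^ 4 / 1024) / Sst ^ 2 + (n : ℝ) ^ c / 64 ≤
      (π ^ 2 / 4) ^ c * (π ^ 4 / 1024 + (c : ℝ) ^ 2 * π ^ 4 * (n : ℝ) ^ c / 64) * (Fst ^ 2 / Sst ^ 2) := by
    -- (π²/4)^c · Fst² ≥ 1 and Sst² ≤ c²π⁴
    have hA : 1 ≤ (π ^ 2 / 4) ^ c * Fst ^ 2 := by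
      have e : (π ^ 2 / 4) ^ c * ((2 / π) ^ c) ^ 2 = 1 := by
        have h22 : (((2 : ℝ) / π) ^ c) ^ 2 = ((2 / π) ^ 2) ^ c := by rw [← pow_mul, ← pow_mul, mul_comm]
        have : π ^ 2 / 4 * (2 / π) ^ 2 = 1 := by field_simp; ring
        rw [h22, ← mul_pow, this, one_pow]
      have h2 : ((2 / π) ^ c) ^ 2 ≤ Fst ^ 2 := pow_le_pow_left₀ (by positivity) hFst_ge 2
      calc (1 : ℝ) = (π ^ 2 / 4) ^ c * ((2 / π) ^ c) ^ 2 := e.symm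
        _ ≤ (π ^ 2 / 4) ^ c * Fst ^ 2 := by gcongr
    have hB : Sst ^ 2 ≤ (c : ℝ) ^ 2 * π ^ 4 := by
      have := pow_le_pow_left₀ hSst_pos.le hSst_le 2
      calc Sst ^ 2 ≤ (c * π ^ 2) ^ 2 := this
        _ = (c : ℝ) ^ 2 * π ^ 4 := by ring
    have hS2 : 0 < Sst ^ 2 := by positivity
    rw [show (π ^ 2 / 4) ^ c * (π ^ 4 / 1024 + (c : ℝ) ^ 2 * π ^ 4 * (n : ℝ) ^ c / 64) * (Fst ^ 2 / Sst ^ 2)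
        = ((π ^ 2 / 4) ^ c * Fst ^ 2) * (π ^ 4 / 1024 + (c : ℝ) ^ 2 * π ^ 4 * (n : ℝ) ^ c / 64) / Sst ^ 2 by ring]
    rw [div_add' _ _ _ (ne_of_gt hS2), div_le_div_iff₀ hS2 hS2]
    have hX : 0 ≤ π ^ 4 / 1024 + (c : ℝ) ^ 2 * π ^ 4 * (n : ℝ) ^ c / 64 := by positivity
    have step1 : π ^ 4 / 1024 + (n : ℝ) ^ c / 64 * Sst ^ 2 ≤
        π ^ 4 / 1024 + (c : ℝ) ^ 2 * π ^ 4 * (n : ℝ) ^ c / 64 := by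
      have : (n : ℝ) ^ c / 64 * Sst ^ 2 ≤ (n : ℝ) ^ c / 64 * ((c : ℝ) ^ 2 * π ^ 4) :=
        mul_le_mul_of_nonneg_left hB (by positivity)
      linarith
    calc (π ^ 4 / 1024 + (n : ℝ) ^ c / 64 * Sst ^ 2) * Sst ^ 2
        ≤ (π ^ 4 / 1024 + (c : ℝ) ^ 2 * π ^ 4 * (n : ℝ) ^ c / 64) * Sst ^ 2 := by gcongr
      _ = 1 * (π ^ 4 / 1024 + (c : ℝ) ^ 2 * π ^ 4 * (n : ℝ) ^ c / 64) * Sst ^ 2 := by ring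
      _ ≤ ((π ^ 2 / 4) ^ c * Fst ^ 2) * (π ^ 4 / 1024 + (c : ℝ) ^ 2 * π ^ 4 * (n : ℝ) ^ c / 64) * Sst ^ 2 := by
          gcongr
  calc ∑ m : ι → Fin n, (1 - ∏ κ, F (θ κ) (m κ)) ^ 2 / (∑ κ, S (θ κ) (m κ)) ^ 4
      ≤ (π ^ 4 / 1024) / Sst ^ 2 + (n : ℝ) ^ c / 64 := hL
    _ ≤ (π ^ 2 / 4) ^ c * (π ^ 4 / 1024 + (c : ℝ) ^ 2 * π ^ 4 * (n : ℝ) ^ c / 64) * (Fst ^ 2 / Sst ^ 2) := key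
    _ ≤ (π ^ 2 / 4) ^ c * (π ^ 4 / 1024 + (c : ℝ) ^ 2 * π ^ 4 * (n : ℝ) ^ c / 64) *
        ∑ m : ι → Fin n, (∏ κ, F (θ κ) (m κ)) ^ 2 / (∑ κ, S (θ κ) (m κ)) ^ 2 :=
          mul_le_mul_of_nonneg_left hR hC0

end Summit.QuantumFields.YangMills.Theorems.N07AliasSumRobustBound

end
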